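import Summits.AtomisticToContinuum.HydrodynamicLimit.Theses.AntiMazurCoboundaries
import Literature.MathematicalPhysics.KineticTheory.HardSphereEulerProofs
import Summits.AtomisticToContinuum.HydrodynamicLimit.Theorems.AntiMazurCoboundariesShearStressHalfDrudeNetLipschitz
import Summits.AtomisticToContinuum.HydrodynamicLimit.Theorems.AntiMazurCoboundariesShearStressHalfDrudeDisplacement
import Summits.AtomisticToContinuum.HydrodynamicLimit.Theorems.JParityClosureOddContactSymmetryTubeStatRegular

/-!
# Frozen modulation, error term: the influence bound of one redrawn velocity
# (helper sub-stub `stub_frozenModulationErrTerm` serving `stub_frozenModulation_of_loc`, line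
# `cutoff-compactness-net`, crux `AntiMazurCoboundaries.ShearStressHalfDrude`, stmt-AtomisticToContinuum-14136)

For the homogeneous Gibbs law `G = localGibbsLaw σ a u₀ θ N Φ`, `M = N(u₀, θ id)`, a particle `i`, a time `u ≥ 0`,
a bounded measurable one-body velocity observable `k` and a continuous modulation `φ`, the error observable of
the frozen-modulation comparison is `Ψᵢ(z) = φ(xᵢ) Σⱼ (φ(xⱼ(u)) − φ(xᵢ)) k(vⱼ(u))`.  Given
* the one-velocity resampling identity `E_G E_M[k(vᵢ) Ψ(z')] = 0` (`z'` = `z` with velocity `i` redrawn from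
  `M`; tree: `ShearStressHalfDrudeResampling.stub_resamplingOrthogonality`), and
* the exchangeability of the pair `(z, z')` under `G ⊗ M` (SWAP),
`E_G[k(vᵢ) Ψᵢ] = E_{G⊗M}[k(vᵢ)(Ψᵢ(z) − Ψᵢ(z'))]`, and POINTWISE `Ψᵢ(z) − Ψᵢ(z')` only involves the particles
`j` whose time-`u` state differs in the two copies (`abs_modDiff_le`): with `|φ(y) − φ(xᵢ)| ≤ ε + 2‖φ‖∞ 1{δ ≤ d(y, xᵢ)}`
(uniform continuity), each influenced `j ≠ i` costs `2ε + 4‖φ‖∞ 1{far in either copy}` and `i` itself costs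
`2ε + 2‖φ‖∞ (1{δ ≤ d(xᵢ(u), xᵢ)} + 1{δ ≤ d(xᵢ'(u), xᵢ)})`.  Integrating (`stub_frozenModulationErrTerm`):
the counts are left as the iterated integrals of LOC-COUNT / LOC-FAR, the first self term is
`≤ u E‖v‖/δ` by Markov and the mean displacement bound (`ShearStressHalfDrudeDisplacement.stub_meanDisplacement`),
and the primed one equals the first by SWAP.
-/

noncomputable section

namespace Summit.AtomisticToContinuum.HydrodynamicLimit.Theorems

open MeasureTheory ProbabilityTheory Filter Set
open scoped ENNReal InnerProductSpace BigOperators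
open Literature.Analysis.FluidPDE Literature.MathematicalPhysics.KineticTheory

namespace ShearStressHalfDrudeFrozenGlueHelpers

/-! ## Pointwise ingredients: modulus of continuity and the influence bound -/

/-- The sup distance on `𝕋³ = (ℝ/ℤ)³` is dominated by the minimal-image Euclidean distance. [folklore] -/
theorem dist_le_euclidDist (x y : T3) : dist x y ≤ Torus.euclidDist x y :=
  (dist_pi_le_iff (by rw [Torus.euclidDist_eq]; exact norm_nonneg _)).2 fun k => by
    rw [dist_eq_norm]; exact norm_apply_sub_le_euclidDist x y k

/-- Modulus-of-continuity split: `|φ y − φ x| ≤ ε + 2K·1{δ ≤ d(y, x)}` once `dist < δ ⇒ |Δφ| < ε`.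
[folklore] -/
theorem abs_sub_le_eps_add {φ : T3 → ℝ} {K ε δ : ℝ} (hK : ∀ x, |φ x| ≤ K) (hε : 0 ≤ ε)
    (hδ : ∀ x y, dist x y < δ → dist (φ x) (φ y) < ε) (y x : T3) :
    |φ y - φ x| ≤ ε + 2 * K * (if δ ≤ Torus.euclidDist y x then 1 else 0) := by
  by_cases h : δ ≤ Torus.euclidDist y x
  · rw [if_pos h, mul_one]
    linarith [abs_sub (φ y) (φ x), hK y, hK x]
  · rw [if_neg h, mul_zero, add_zero]
    have h' := hδ y x ((dist_le_euclidDist y x).trans_lt (not_le.1 h))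
    rw [Real.dist_eq] at h'
    exact h'.le

/-- **Pointwise influence bound.** Redrawing one velocity changes the modulated sum
`φ(x₀) Σⱼ (φ(xⱼ) − φ(x₀)) G_j` only through the particles `j` whose state differs in the two copies
`a, b`; each such `j ≠ i` costs `2ε + 4K·1{far in either copy}`, the particle `i` itself costs
`2ε + 2K(1{far} + 1{far'})`. [folklore] -/
theorem abs_modDiff_le {n : ℕ} (i : Fin n) {φ : T3 → ℝ} {Kφ ε δ : ℝ} (hKφ : ∀ x, |φ x| ≤ Kφ)
    (hε : 0 ≤ ε) (hδ : ∀ x y, dist x y < δ → dist (φ x) (φ y) < ε) {G : T3 × V3 → ℝ} {Kg : ℝ}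
    (hKg : ∀ q, |G q| ≤ Kg) (x₀ : T3) (a b : Fin n → T3 × V3) :
    |φ x₀ * ∑ j, (φ (a j).1 - φ x₀) * G (a j) - φ x₀ * ∑ j, (φ (b j).1 - φ x₀) * G (b j)| ≤
      Kφ * Kg * (2 * ε * (1 + (((Finset.univ.filter fun j => j ≠ i ∧ a j ≠ b j).card : ℕ) : ℝ)) +
        4 * Kφ * (((Finset.univ.filter fun j => j ≠ i ∧ a j ≠ b j ∧
          (δ ≤ Torus.euclidDist (a j).1 x₀ ∨ δ ≤ Torus.euclidDist (b j).1 x₀)).card : ℕ) : ℝ) +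
        2 * Kφ * ((if δ ≤ Torus.euclidDist (a i).1 x₀ then 1 else 0) +
          (if δ ≤ Torus.euclidDist (b i).1 x₀ then 1 else 0))) := by
  have hKφ0 : 0 ≤ Kφ := (abs_nonneg _).trans (hKφ x₀)
  have hKg0 : 0 ≤ Kg := (abs_nonneg _).trans (hKg (a i))
  have hmod := fun y => abs_sub_le_eps_add hKφ hε hδ y x₀
  have hterm : ∀ j, |(φ (a j).1 - φ x₀) * G (a j) - (φ (b j).1 - φ x₀) * G (b j)| ≤
      Kg * ((if j = i then 2 * ε + 2 * Kφ * ((if δ ≤ Torus.euclidDist (a i).1 x₀ then 1 else 0) +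
          (if δ ≤ Torus.euclidDist (b i).1 x₀ then 1 else 0)) else 0) +
        2 * ε * (if j ≠ i ∧ a j ≠ b j then 1 else 0) +
        4 * Kφ * (if j ≠ i ∧ a j ≠ b j ∧
          (δ ≤ Torus.euclidDist (a j).1 x₀ ∨ δ ≤ Torus.euclidDist (b j).1 x₀) then 1 else 0)) := by
    intro j
    by_cases hab : a j = b j
    · rw [hab, sub_self, abs_zero]; positivity
    have h2 : |(φ (a j).1 - φ x₀) * G (a j) - (φ (b j).1 - φ x₀) * G (b j)| ≤
        Kg * (|φ (a j).1 - φ x₀| + |φ (b j).1 - φ x₀|) := by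
      refine (abs_sub _ _).trans ?_
      rw [abs_mul, abs_mul, mul_add]
      exact add_le_add (by nlinarith [hKg (a j), abs_nonneg (φ (a j).1 - φ x₀), abs_nonneg (G (a j))])
        (by nlinarith [hKg (b j), abs_nonneg (φ (b j).1 - φ x₀), abs_nonneg (G (b j))])
    refine h2.trans (mul_le_mul_of_nonneg_left ?_ hKg0)
    have ha' := hmod (a j).1
    have hb' := hmod (b j).1
    by_cases hj : j = i
    · subst hj
      rw [if_pos rfl, if_neg (show ¬(j ≠ j ∧ a j ≠ b j) from fun h => h.1 rfl),
        if_neg (show ¬(j ≠ j ∧ a j ≠ b j ∧ (δ ≤ Torus.euclidDist (a j).1 x₀ ∨ δ ≤ Torus.euclidDist (b j).1 x₀))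
          from fun h => h.1 rfl), mul_zero, mul_zero, add_zero, add_zero]
      linarith
    · rw [if_neg hj, if_pos ⟨hj, hab⟩, zero_add, mul_one]
      have h1 : (if δ ≤ Torus.euclidDist (a j).1 x₀ then (1 : ℝ) else 0) ≤ 1 := by split_ifs <;> norm_num
      have h1' : (if δ ≤ Torus.euclidDist (b j).1 x₀ then (1 : ℝ) else 0) ≤ 1 := by split_ifs <;> norm_num
      by_cases hfar : δ ≤ Torus.euclidDist (a j).1 x₀ ∨ δ ≤ Torus.euclidDist (b j).1 x₀
      · rw [if_pos ⟨hj, hab, hfar⟩, mul_one]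
        nlinarith
      · rw [if_neg (fun h => hfar h.2.2), mul_zero, add_zero]
        rw [not_or] at hfar
        rw [if_neg hfar.1] at ha'
        rw [if_neg hfar.2] at hb'
        linarith
  calc |φ x₀ * ∑ j, (φ (a j).1 - φ x₀) * G (a j) - φ x₀ * ∑ j, (φ (b j).1 - φ x₀) * G (b j)|
      = |φ x₀| * |∑ j, ((φ (a j).1 - φ x₀) * G (a j) - (φ (b j).1 - φ x₀) * G (b j))| := by
        rw [← mul_sub, ← Finset.sum_sub_distrib, abs_mul]
    _ ≤ Kφ * ∑ j, |(φ (a j).1 - φ x₀) * G (a j) - (φ (b j).1 - φ x₀) * G (b j)| :=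
        mul_le_mul (hKφ x₀) (Finset.abs_sum_le_sum_abs _ _) (abs_nonneg _) hKφ0
    _ ≤ Kφ * ∑ j, (Kg * ((if j = i then 2 * ε + 2 * Kφ * ((if δ ≤ Torus.euclidDist (a i).1 x₀ then 1 else 0) +
          (if δ ≤ Torus.euclidDist (b i).1 x₀ then 1 else 0)) else 0) +
        2 * ε * (if j ≠ i ∧ a j ≠ b j then 1 else 0) +
        4 * Kφ * (if j ≠ i ∧ a j ≠ b j ∧
          (δ ≤ Torus.euclidDist (a j).1 x₀ ∨ δ ≤ Torus.euclidDist (b j).1 x₀) then 1 else 0))) :=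
        mul_le_mul_of_nonneg_left (Finset.sum_le_sum fun j _ => hterm j) hKφ0
    _ = _ := by
        rw [Finset.natCast_card_filter, Finset.natCast_card_filter, ← Finset.mul_sum, Finset.sum_add_distrib,
          Finset.sum_add_distrib, Finset.sum_ite_eq', ← Finset.mul_sum, ← Finset.mul_sum]
        simp only [Finset.mem_univ, if_true]
        ring

/-! ## The one-particle error bound -/

/-- **Error term of one particle** (helper sub-stub `stub_frozenModulationErrTerm`, all binders explicit).
Under the one-velocity resampling identity (hypothesis `horth`) and the exchangeability of the resampled pair
(hypothesis `hswap`), `E_G[k(vᵢ) Ψᵢ] = E_{G⊗M}[k(vᵢ)(Ψᵢ(z) − Ψᵢ(z'))]` is bounded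
by the pointwise influence bound integrated: influence counts, far-influence counts, and the two self terms
`P(δ ≤ d(xᵢ(u), xᵢ)) ≤ u·E‖v‖/δ` (Markov + `stub_meanDisplacement`; the primed one via `hswap`). [folklore] -/
theorem stub_frozenModulationErrTerm :
    ∀ (σ a θ : ℝ) (u₀ : V3), σ ≤ 1 / 2 → 0 < a → 0 < θ →
    ∀ (N : ℕ) (Φ : HardSphereFlow (Torus.geometry (Fin 3)) (hsDiameter σ N) (N + 1)) (i : Fin (N + 1))
      (φ : T3 → ℝ), Continuous φ → ∀ (Kφ ε δ : ℝ), (∀ x, |φ x| ≤ Kφ) → 0 ≤ ε → 0 < δ →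
      (∀ x y : T3, dist x y < δ → dist (φ x) (φ y) < ε) →
    ∀ (k : V3 → ℝ), Measurable k → ∀ (Kg : ℝ), (∀ v, |k v| ≤ Kg) → ∀ (u : ℝ), 0 ≤ u →
      (∀ Ψ : Config (N + 1) (Fin 3) T3 → ℝ, Measurable Ψ → (∃ C : ℝ, ∀ z, |Ψ z| ≤ C) →
        ∫ z, ∫ v', k (z i).2 * Ψ (Function.update z i ((z i).1, v')) ∂(gaussMeasure u₀ θ)
          ∂(localGibbsLaw σ (fun _ => a) (fun _ => u₀) (fun _ => θ) N Φ) = 0) →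
      (∀ H : Config (N + 1) (Fin 3) T3 → Config (N + 1) (Fin 3) T3 → ℝ≥0∞, Measurable (Function.uncurry H) →
        ∫⁻ z, ∫⁻ v', H z (Function.update z i ((z i).1, v')) ∂(gaussMeasure u₀ θ)
            ∂(localGibbsLaw σ (fun _ => a) (fun _ => u₀) (fun _ => θ) N Φ) =
          ∫⁻ z, ∫⁻ v', H (Function.update z i ((z i).1, v')) z ∂(gaussMeasure u₀ θ)
            ∂(localGibbsLaw σ (fun _ => a) (fun _ => u₀) (fun _ => θ) N Φ)) →
    ∫ z, k (z i).2 * (φ (z i).1 * ∑ j, (φ (Φ.flow u z j).1 - φ (z i).1) * k (Φ.flow u z j).2)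
        ∂(localGibbsLaw σ (fun _ => a) (fun _ => u₀) (fun _ => θ) N Φ) ≤
      Kg * (Kφ * Kg * (2 * ε * (1 + ∫ z, ∫ v', (((Finset.univ.filter fun j : Fin (N + 1) =>
          j ≠ i ∧ Φ.flow u z j ≠ Φ.flow u (Function.update z i ((z i).1, v')) j).card : ℕ) : ℝ)
          ∂(gaussMeasure u₀ θ) ∂(localGibbsLaw σ (fun _ => a) (fun _ => u₀) (fun _ => θ) N Φ)) +
        4 * Kφ * ∫ z, ∫ v', (((Finset.univ.filter fun j : Fin (N + 1) =>
          j ≠ i ∧ Φ.flow u z j ≠ Φ.flow u (Function.update z i ((z i).1, v')) j ∧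
          (δ ≤ Torus.euclidDist (Φ.flow u z j).1 (z i).1 ∨
            δ ≤ Torus.euclidDist (Φ.flow u (Function.update z i ((z i).1, v')) j).1 (z i).1)).card : ℕ) : ℝ)
          ∂(gaussMeasure u₀ θ) ∂(localGibbsLaw σ (fun _ => a) (fun _ => u₀) (fun _ => θ) N Φ) +
        4 * Kφ * (u * (∫ v, ‖v‖ ∂(gaussMeasure u₀ θ)) / δ))) := by
  intro σ a θ u₀ hσ ha hθ N Φ i φ hφ Kφ ε δ hKφ hε hδ0 hδ k hk Kg hKg u hu horth hswap
  set G := localGibbsLaw σ (fun _ => a) (fun _ => u₀) (fun _ => θ) N Φ with hG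
  set M := gaussMeasure u₀ θ with hM
  haveI : IsProbabilityMeasure G :=
    isProbabilityMeasure_localGibbsLaw continuous_const continuous_const continuous_const
      (fun _ => ha) (fun _ => hθ) hσ N Φ
  set T := Φ.flow u with hT
  have hTm : Measurable T := Φ.measurable_flow u
  have hTj : ∀ j, Measurable fun z : Config (N + 1) (Fin 3) T3 => T z j := fun j =>
    (measurable_pi_apply j).comp hTm
  have hKg0 : 0 ≤ Kg := (abs_nonneg _).trans (hKg 0)
  have hKφ0 : 0 ≤ Kφ := (abs_nonneg _).trans (hKφ 0)
  -- the resampling map `U (z, v') = z with velocity i replaced by v'`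
  set U : Config (N + 1) (Fin 3) T3 × V3 → Config (N + 1) (Fin 3) T3 :=
    fun p => Function.update p.1 i ((p.1 i).1, p.2) with hU
  have hUm : Measurable U := (measurable_update' (a := i)).comp
    (measurable_fst.prodMk (((measurable_pi_apply i).comp measurable_fst).fst.prodMk measurable_snd))
  have hUi : ∀ p, (U p i).1 = (p.1 i).1 := fun p => by simp [hU]
  -- the modulated error observable `Ψ`
  set Ψ : Config (N + 1) (Fin 3) T3 → ℝ :=
    fun z => φ (z i).1 * ∑ j, (φ (T z j).1 - φ (z i).1) * k (T z j).2 with hΨ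
  have hΨm : Measurable Ψ := by rw [hΨ]; fun_prop
  have hdφ : ∀ x y, |φ x - φ y| ≤ 2 * Kφ := fun x y => (abs_sub _ _).trans (by linarith [hKφ x, hKφ y])
  have hΨb : ∀ z, |Ψ z| ≤ Kφ * ((N + 1 : ℕ) * (2 * Kφ * Kg)) := fun z => by
    rw [hΨ, abs_mul]
    exact mul_le_mul (hKφ _) (ShearStressHalfDrudeNetLipschitz.abs_sum_mul_le (fun j => hdφ _ _)
      (fun j => hKg _)) (abs_nonneg _) hKφ0
  -- Step 1: resampling — `E_G[k Ψ] = E_{G⊗M}[k (Ψ − Ψ ∘ U)]`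
  have hI1 : Integrable (fun p : Config (N + 1) (Fin 3) T3 × V3 => k (p.1 i).2 * Ψ p.1) (G.prod M) :=
    Integrable.of_bound (by fun_prop : Measurable fun p : Config (N + 1) (Fin 3) T3 × V3 =>
      k (p.1 i).2 * Ψ p.1).aestronglyMeasurable (Kg * (Kφ * ((N + 1 : ℕ) * (2 * Kφ * Kg))))
      (ae_of_all _ fun p => by
        rw [Real.norm_eq_abs, abs_mul]; exact mul_le_mul (hKg _) (hΨb _) (abs_nonneg _) hKg0)
  have hI2 : Integrable (fun p : Config (N + 1) (Fin 3) T3 × V3 => k (p.1 i).2 * Ψ (U p)) (G.prod M) :=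
    Integrable.of_bound ((hk.comp ((measurable_pi_apply i).comp measurable_fst).snd).mul
      (hΨm.comp hUm)).aestronglyMeasurable (Kg * (Kφ * ((N + 1 : ℕ) * (2 * Kφ * Kg))))
      (ae_of_all _ fun p => by
        rw [Real.norm_eq_abs, abs_mul]; exact mul_le_mul (hKg _) (hΨb _) (abs_nonneg _) hKg0)
  have hL : ∫ z, k (z i).2 * Ψ z ∂G = ∫ p, k (p.1 i).2 * (Ψ p.1 - Ψ (U p)) ∂(G.prod M) := by
    have h0 : ∫ p, k (p.1 i).2 * Ψ (U p) ∂(G.prod M) = 0 := by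
      rw [integral_prod _ hI2]; exact horth Ψ hΨm ⟨_, hΨb⟩
    have h1 := integral_fun_fst (μ := G) (ν := M) (fun z => k (z i).2 * Ψ z)
    rw [probReal_univ, one_smul] at h1
    calc ∫ z, k (z i).2 * Ψ z ∂G
        = (∫ p, k (p.1 i).2 * Ψ p.1 ∂(G.prod M)) - ∫ p, k (p.1 i).2 * Ψ (U p) ∂(G.prod M) := by
          rw [h1, h0, sub_zero]
      _ = ∫ p, (k (p.1 i).2 * Ψ p.1 - k (p.1 i).2 * Ψ (U p)) ∂(G.prod M) := (integral_sub hI1 hI2).symm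
      _ = _ := by simp only [mul_sub]
  -- Step 2: the pointwise influence bound
  set cardD : Config (N + 1) (Fin 3) T3 × V3 → ℝ := fun p =>
    (((Finset.univ.filter fun j : Fin (N + 1) => j ≠ i ∧ T p.1 j ≠ T (U p) j).card : ℕ) : ℝ) with hcardD
  set cardF : Config (N + 1) (Fin 3) T3 × V3 → ℝ := fun p =>
    (((Finset.univ.filter fun j : Fin (N + 1) => j ≠ i ∧ T p.1 j ≠ T (U p) j ∧
      (δ ≤ Torus.euclidDist (T p.1 j).1 (p.1 i).1 ∨ δ ≤ Torus.euclidDist (T (U p) j).1 (p.1 i).1)).card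
        : ℕ) : ℝ) with hcardF
  set s₀ : Config (N + 1) (Fin 3) T3 → ℝ := fun z =>
    if δ ≤ Torus.euclidDist (T z i).1 (z i).1 then 1 else 0 with hs₀
  set s' : Config (N + 1) (Fin 3) T3 × V3 → ℝ := fun p =>
    if δ ≤ Torus.euclidDist (T (U p) i).1 (p.1 i).1 then 1 else 0 with hs'
  have hpt : ∀ p : Config (N + 1) (Fin 3) T3 × V3, k (p.1 i).2 * (Ψ p.1 - Ψ (U p)) ≤
      Kg * (Kφ * Kg * (2 * ε * (1 + cardD p) + 4 * Kφ * cardF p + 2 * Kφ * (s₀ p.1 + s' p))) := by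
    intro p
    have h1 := abs_modDiff_le i hKφ hε hδ (G := fun q : T3 × V3 => k q.2) (fun q => hKg q.2) (p.1 i).1
      (T p.1) (T (U p))
    have h2 : Ψ p.1 - Ψ (U p) = φ (p.1 i).1 * ∑ j, (φ (T p.1 j).1 - φ (p.1 i).1) * k (T p.1 j).2 -
        φ (p.1 i).1 * ∑ j, (φ (T (U p) j).1 - φ (p.1 i).1) * k (T (U p) j).2 := by
      simp only [hΨ, hUi]
    calc k (p.1 i).2 * (Ψ p.1 - Ψ (U p)) ≤ |k (p.1 i).2| * |Ψ p.1 - Ψ (U p)| := by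
          rw [← abs_mul]; exact le_abs_self _
      _ ≤ Kg * _ := by rw [h2]; exact mul_le_mul (hKg _) h1 (abs_nonneg _) hKg0
  -- Step 3: measurability / integrability of the counts and indicators
  have hne : ∀ j, Measurable fun p : Config (N + 1) (Fin 3) T3 × V3 => j ≠ i ∧ T p.1 j ≠ T (U p) j :=
    fun j => measurable_const.and (((hTj j).comp measurable_fst).eq ((hTj j).comp hUm)).not
  have hdist₁ : ∀ j, Measurable fun p : Config (N + 1) (Fin 3) T3 × V3 =>
      Torus.euclidDist (T p.1 j).1 (p.1 i).1 := fun j =>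
    measurable_euclidDist_comp ((hTj j).comp measurable_fst).fst ((measurable_pi_apply i).comp measurable_fst).fst
  have hdist₂ : ∀ j, Measurable fun p : Config (N + 1) (Fin 3) T3 × V3 =>
      Torus.euclidDist (T (U p) j).1 (p.1 i).1 := fun j =>
    measurable_euclidDist_comp ((hTj j).comp hUm).fst ((measurable_pi_apply i).comp measurable_fst).fst
  have hfar : ∀ j, Measurable fun p : Config (N + 1) (Fin 3) T3 × V3 =>
      δ ≤ Torus.euclidDist (T p.1 j).1 (p.1 i).1 ∨ δ ≤ Torus.euclidDist (T (U p) j).1 (p.1 i).1 := fun j =>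
    (measurable_const.le' (hdist₁ j)).or (measurable_const.le' (hdist₂ j))
  have hcard_le : ∀ (q : Fin (N + 1) → Prop) [DecidablePred q],
      ‖(((Finset.univ.filter q).card : ℕ) : ℝ)‖ ≤ (N + 1 : ℕ) := fun q _ => by
    rw [Real.norm_of_nonneg (Nat.cast_nonneg _)]
    exact_mod_cast (Finset.card_filter_le _ _).trans (by simp)
  have hDm : Measurable cardD := by
    simp only [hcardD, Finset.natCast_card_filter]
    exact Finset.measurable_sum _ fun j _ =>
      Measurable.ite (measurableSet_setOf.2 (hne j)) measurable_const measurable_const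
  have hFm : Measurable cardF := by
    simp only [hcardF, Finset.natCast_card_filter]
    exact Finset.measurable_sum _ fun j _ =>
      Measurable.ite (measurableSet_setOf.2 (measurable_const.and
        ((((hTj j).comp measurable_fst).eq ((hTj j).comp hUm)).not.and (hfar j))))
        measurable_const measurable_const
  have hDi : Integrable cardD (G.prod M) :=
    Integrable.of_bound hDm.aestronglyMeasurable _ (ae_of_all _ fun p => hcard_le _)
  have hFi : Integrable cardF (G.prod M) :=
    Integrable.of_bound hFm.aestronglyMeasurable _ (ae_of_all _ fun p => hcard_le _)
  have hd₀ : Measurable fun z : Config (N + 1) (Fin 3) T3 => Torus.euclidDist (T z i).1 (z i).1 :=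
    measurable_euclidDist_comp (hTj i).fst (measurable_pi_apply i).fst
  have hS₀ : MeasurableSet {z : Config (N + 1) (Fin 3) T3 | δ ≤ Torus.euclidDist (T z i).1 (z i).1} :=
    measurableSet_le measurable_const hd₀
  have hS' : MeasurableSet {p : Config (N + 1) (Fin 3) T3 × V3 |
      δ ≤ Torus.euclidDist (T (U p) i).1 (p.1 i).1} := measurableSet_le measurable_const (hdist₂ i)
  have hite_le : ∀ (c : Prop) [Decidable c], ‖(if c then (1 : ℝ) else 0)‖ ≤ 1 := fun c _ => by
    split_ifs <;> simp
  have hs₀m : Measurable s₀ := Measurable.ite hS₀ measurable_const measurable_const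
  have hsi : Integrable (fun p : Config (N + 1) (Fin 3) T3 × V3 => s₀ p.1) (G.prod M) :=
    Integrable.of_bound (hs₀m.comp measurable_fst).aestronglyMeasurable 1 (ae_of_all _ fun p => hite_le _)
  have hs'i : Integrable s' (G.prod M) :=
    Integrable.of_bound (Measurable.ite hS' measurable_const measurable_const).aestronglyMeasurable 1
      (ae_of_all _ fun p => hite_le _)
  -- Step 4: the two self terms (Markov + mean displacement; the primed one by exchangeability)
  have hmarkov : G {z | δ ≤ Torus.euclidDist (T z i).1 (z i).1} ≤
      ENNReal.ofReal (u * (∫ v, ‖v‖ ∂M) / δ) := by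
    have hdm : AEMeasurable (fun z => ENNReal.ofReal (Torus.euclidDist (T z i).1 (z i).1)) G :=
      hd₀.ennreal_ofReal.aemeasurable
    calc G {z | δ ≤ Torus.euclidDist (T z i).1 (z i).1}
        ≤ G {z | ENNReal.ofReal δ ≤ ENNReal.ofReal (Torus.euclidDist (T z i).1 (z i).1)} :=
          measure_mono fun z hz => ENNReal.ofReal_le_ofReal hz
      _ ≤ (∫⁻ z, ENNReal.ofReal (Torus.euclidDist (T z i).1 (z i).1) ∂G) / ENNReal.ofReal δ :=
          meas_ge_le_lintegral_div hdm (ENNReal.ofReal_pos.2 hδ0).ne' ENNReal.ofReal_ne_top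
      _ ≤ ENNReal.ofReal (u * ∫ v, ‖v‖ ∂M) / ENNReal.ofReal δ := by
          gcongr
          exact ShearStressHalfDrudeDisplacement.stub_meanDisplacement σ a θ u₀ hσ ha hθ N Φ i u hu
      _ = ENNReal.ofReal (u * (∫ v, ‖v‖ ∂M) / δ) := (ENNReal.ofReal_div_of_pos hδ0).symm
  have hs_int : ∫ p, s₀ p.1 ∂(G.prod M) ≤ u * (∫ v, ‖v‖ ∂M) / δ := by
    have h1 := integral_fun_fst (μ := G) (ν := M) s₀
    rw [probReal_univ, one_smul] at h1
    rw [h1]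
    have h2 : ∫ z, s₀ z ∂G = G.real {z | δ ≤ Torus.euclidDist (T z i).1 (z i).1} := by
      rw [← integral_indicator_one hS₀]
      refine integral_congr_ae (ae_of_all _ fun z => ?_)
      by_cases hz : δ ≤ Torus.euclidDist (T z i).1 (z i).1 <;> simp [hs₀, hz]
    rw [h2]
    exact ENNReal.toReal_le_of_le_ofReal (by positivity) hmarkov
  have hs'_int : ∫ p, s' p ∂(G.prod M) ≤ u * (∫ v, ‖v‖ ∂M) / δ := by
    have h1 : ∫ p, s' p ∂(G.prod M) =
        (G.prod M).real {p | δ ≤ Torus.euclidDist (T (U p) i).1 (p.1 i).1} := by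
      rw [← integral_indicator_one hS']
      refine integral_congr_ae (ae_of_all _ fun p => ?_)
      by_cases hp : δ ≤ Torus.euclidDist (T (U p) i).1 (p.1 i).1 <;> simp [hs', hp]
    rw [h1]
    refine ENNReal.toReal_le_of_le_ofReal (by positivity) ?_
    -- exchangeability: `P(δ ≤ d(xᵢ'(u), xᵢ)) = P(δ ≤ d(xᵢ(u), xᵢ))`
    have hQ : MeasurableSet {q : Config (N + 1) (Fin 3) T3 × Config (N + 1) (Fin 3) T3 |
        δ ≤ Torus.euclidDist (T q.2 i).1 (q.1 i).1} :=
      measurableSet_le measurable_const (measurable_euclidDist_comp ((hTj i).comp measurable_snd).fst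
        ((measurable_pi_apply i).comp measurable_fst).fst)
    have hsw := hswap (fun z w => {q : Config (N + 1) (Fin 3) T3 × Config (N + 1) (Fin 3) T3 |
        δ ≤ Torus.euclidDist (T q.2 i).1 (q.1 i).1}.indicator 1 (z, w))
      ((measurable_one.indicator hQ).comp (measurable_fst.prodMk measurable_snd))
    have hlhs : (G.prod M) {p | δ ≤ Torus.euclidDist (T (U p) i).1 (p.1 i).1} =
        ∫⁻ z, ∫⁻ v', {q : Config (N + 1) (Fin 3) T3 × Config (N + 1) (Fin 3) T3 |
          δ ≤ Torus.euclidDist (T q.2 i).1 (q.1 i).1}.indicator 1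
            (z, Function.update z i ((z i).1, v')) ∂M ∂G := by
      rw [← lintegral_indicator_one hS', lintegral_prod _ (measurable_one.indicator hS').aemeasurable]
      refine lintegral_congr fun z => lintegral_congr fun v' => ?_
      simp only [indicator_apply, mem_setOf_eq, hU, Pi.one_apply]
    have hrhs : ∫⁻ z, ∫⁻ v', {q : Config (N + 1) (Fin 3) T3 × Config (N + 1) (Fin 3) T3 |
          δ ≤ Torus.euclidDist (T q.2 i).1 (q.1 i).1}.indicator 1
            (Function.update z i ((z i).1, v'), z) ∂M ∂G =
        G {z | δ ≤ Torus.euclidDist (T z i).1 (z i).1} := by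
      rw [← lintegral_indicator_one hS₀]
      refine lintegral_congr fun z => ?_
      have : ∀ v' : V3, {q : Config (N + 1) (Fin 3) T3 × Config (N + 1) (Fin 3) T3 |
          δ ≤ Torus.euclidDist (T q.2 i).1 (q.1 i).1}.indicator 1 (Function.update z i ((z i).1, v'), z) =
          {z : Config (N + 1) (Fin 3) T3 | δ ≤ Torus.euclidDist (T z i).1 (z i).1}.indicator
            (1 : Config (N + 1) (Fin 3) T3 → ℝ≥0∞) z := fun v' => by
        simp only [indicator_apply, mem_setOf_eq, Function.update_self, Pi.one_apply]
      simp only [this, lintegral_const, measure_univ, mul_one]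
    calc (G.prod M) {p | δ ≤ Torus.euclidDist (T (U p) i).1 (p.1 i).1} = _ := hlhs
      _ = _ := hsw
      _ = _ := hrhs
      _ ≤ _ := hmarkov
  -- Step 5: integrate the pointwise bound
  have hIL : Integrable (fun p : Config (N + 1) (Fin 3) T3 × V3 => k (p.1 i).2 * (Ψ p.1 - Ψ (U p)))
      (G.prod M) := by
    refine (hI1.sub hI2).congr (ae_of_all _ fun p => ?_)
    simp only [Pi.sub_apply, mul_sub]
  have iA : Integrable (fun p : Config (N + 1) (Fin 3) T3 × V3 => 2 * ε * (1 + cardD p)) (G.prod M) :=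
    ((integrable_const (1 : ℝ)).add hDi).const_mul (2 * ε)
  have iB : Integrable (fun p : Config (N + 1) (Fin 3) T3 × V3 => 4 * Kφ * cardF p) (G.prod M) :=
    hFi.const_mul _
  have iC : Integrable (fun p : Config (N + 1) (Fin 3) T3 × V3 => 2 * Kφ * (s₀ p.1 + s' p)) (G.prod M) :=
    (hsi.add hs'i).const_mul _
  have iAB : Integrable (fun p : Config (N + 1) (Fin 3) T3 × V3 =>
      2 * ε * (1 + cardD p) + 4 * Kφ * cardF p) (G.prod M) := iA.add iB
  have hIR : Integrable (fun p : Config (N + 1) (Fin 3) T3 × V3 =>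
      Kg * (Kφ * Kg * (2 * ε * (1 + cardD p) + 4 * Kφ * cardF p + 2 * Kφ * (s₀ p.1 + s' p)))) (G.prod M) :=
    ((iAB.add iC).const_mul _).const_mul _
  rw [hL]
  refine (integral_mono hIL hIR hpt).trans ?_
  rw [integral_const_mul, integral_const_mul, integral_add iAB iC, integral_add iA iB, integral_const_mul,
    integral_const_mul, integral_const_mul, integral_add (integrable_const _) hDi, integral_add hsi hs'i,
    integral_const, probReal_univ, one_smul, integral_prod _ hDi, integral_prod _ hFi]
  have h4 : 2 * Kφ * (∫ p, s₀ p.1 ∂(G.prod M) + ∫ p, s' p ∂(G.prod M)) ≤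
      4 * Kφ * (u * (∫ v, ‖v‖ ∂M) / δ) := by nlinarith [hs_int, hs'_int, hKφ0]
  refine mul_le_mul_of_nonneg_left (mul_le_mul_of_nonneg_left ?_ (mul_nonneg hKφ0 hKg0)) hKg0
  simp only [hcardD, hcardF, hU]
  linarith [h4]

end ShearStressHalfDrudeFrozenGlueHelpers

end Summit.AtomisticToContinuum.HydrodynamicLimit.Theorems

end
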